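import Literature.IUT.HodgeArakelov.BadPrimeGaussianMonoidsGenuineRecordOrbitOfOrbitLift
import Literature.IUT.HodgeArakelov.BadPrimeGaussianMonoidsGenuineRecordSplittingPair
import Literature.IUT.HodgeArakelov.EtaleThetaDataH14OrbitOfThetaKummer
import Literature.IUT.HodgeArakelov.ThetaEvaluationSettingModelOfOrbitLift
import Literature.IUT.HodgeArakelov.EtaleThetaDataOfSettingCyclotomeTower
import HarnessLib

/-!
# [IUTchII] Prop 3.1 (i) / Cor 3.5 (ii) / Prop 2.2 (ii) at the GENERIC `θ_env` data with the class-level inversion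
# binder `h14orbit` PRODUCED from the FUNCTION-level [EtTh] Prop 1.4 (ii) package (proof-only consumer end-knit)

S. Mochizuki, *Inter-universal Teichmüller theory II*, kurims Dec-2020 manuscript (render IUTchII-kurims-url-5036b4059555):
Prop 2.2 (ii) p. 66, Rmk 2.1.1 (i) p. 65, Cor 2.8 (i) p. 82, Prop 3.1 (i) p. 87 («splittings up to torsion»), Cor 3.5 (ii) p. 95
[claim: Mochizuki2012, status: disputed] (IUTchII §3 Prop 3.1 (i), kurims p.87); S. Mochizuki, *The étale theta function and
its Frobenioid-theoretic manifestations* [EtTh], Publ. RIMS **45** (2009) (refereed; pages = PRIMS journal PDF): Prop 1.4 (ii)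
p. 22 («`Θ̈(Ü) = −Θ̈(Ü⁻¹)`», «`Θ̈(−Ü) = −Θ̈(Ü)`»), Prop 1.5 (ii)(iii) p. 23, Thm 1.6 (iii) p. 24, Def 2.7 p. 41, Cor 2.19 (ii) p. 64
[cite: MochizukiEtTh2009, Prop 1.4 (ii) p.22].

Cell `abc-iut`, layer L6, seat abc-iut-w4-d035 (gen 12); cone nodes **IUTchII:Prop3.1(i)** (dag id `N_IUTchII_Prop3_1_i`),
**IUTchII:Cor3.5(ii)**, **IUTchII:Prop2.2(ii)**; GAP-LEDGER row D-G-w4d010-2f (binder of record `h14orbit`). Director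
g4-D7 (2026-08-27T02:06Z (2)) re-key of the held-stale row IUTchII:Prop3.1(i). PROOF-ONLY companion: NO definition, NO `Prop`
fact, NO instance; every input is consumed BY NAME; nothing landed is edited or restated.

WHY / WHAT IS NEW. The two L6 rows still `landed` (abc-iut-L6-lead NODES v3.4by: «gated on L2's class-level (α)-orbit producer»)
take as their ONE remaining class-level input the ORBIT binder `h14orbit : ∃ τ₀ ∈ Π^tp_X̲̲ ∩ Π^tp_Y, autMap(ι|, ι^Θ)(η̈^Θ|_{Π^tp_Ÿ̲̲}) =
τ₀ · η̈^Θ|` (abc-iut-w4-d010 p457679 / p457998). Two function-level routes are ALREADY in the tree and are NOT redone here: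
abc-iut-w4-d004's file 9 `BadPrimeGaussianMonoidsGenuineRecordOrbitOfThetaKummer` (p441895; `rootLevel_inputs_of_thetaKummer`,
`horb_and_hroots_toRecord_inversion_of_thetaKummer`) and abc-iut-w4-d010's `prop22_ii'_model_of_thetaKummer(')`/`_of_ab`/`_of_aut`
discharge ALL THREE class-level clauses (sign, orbit, free) from abc-iut-w5-d125's FULL function-level package (extra binders: the
coordinate `Ü` with roots of its powers, the translate identity `hpow`, a `ℚ`-valued order function, `Λ(Fn) ≅ Δ_Θ` bijective, …).
THIS FILE is the HYBRID route of record's shape: the ORBIT clause alone is taken from abc-iut-L2-t12's MINIMAL function-level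
package — PRODUCER p465052 `EtaleThetaDataOfSetting.h14orbit_of_thetaKummer` (GAP-LEDGER D-G-w4d010-2f 19:50:13Z «producer-under-
function-carrier: closed-by p465052»; it concludes the binder CHARACTER FOR CHARACTER and had NO consumer in the tree), while the
sign / free clauses come from the NAMED FACTS (`h14sign_of_prop15iii` F-0591, `h14free_of_prop15_of_origin` F-0591/F-2503/F-2498) as
in the closers of record; the deck element from `exists_deck_element`, `hker` from abc-iut-w4-d041's `hfix_of_cyclotomeTower` +
`hker_coh_of_fixed`; everything at an ARBITRARY theta setting (abc-iut-w5-d072's stage-2 template p460211 made generic). NEW in kernel: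
* `EtaleThetaDataOfSetting.rootLevel_inputs_of_thetaKummerOrbit(_of_prop15_of_origin)` — root-class-level (R2)(R3) `hsign`/`hroot`/`hfree`;
* `EtaleLevels.horb_toRecord_/hroots_toRecord_inversion_of_thetaKummerOrbit` — the Cor 3.5 (ii) junction inputs `horb`/`hroots`
  at the GENUINE `θ_env` record (p457998 twins; the raw Prop 2.2 (ii) limit clause `horbit` follows identically and is omitted);
* **`EtaleLevels.splitting_toRecord_padic_of_eval_inversion_of_thetaKummerOrbit`** — [IUTchII] Prop 3.1 (i) «splittings up to
  torsion» over `ℚ̄_pˣ` (junction J3) = abc-iut-w4-d004's closer of record p441594 for the pointed-inversion PAIR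
  `(inversionAlpha C ι hι, ι^Θ)` with (R2)(R3) and `hker` ALL DISCHARGED — the first GENERIC form of the J3 closer with NO
  class-level binder (so far only at `modelχq`/`modelTate`, p460211/p460881);
* `EtaleThetaDataOfSetting.prop22_ii'_model_of_inversion_/of_hinv_of_thetaKummerOrbit_of_prop15_of_origin` — node IUTchII:Prop2.2(ii).
RESIDUAL BY NAME (all binders): the inversion datum (`ι`, `hι`, companion `cι`, `ℤ`-reversal `hZι` at a `toLZ`-generator `γ`,
`ι² = conj δ`, `ι ≡ +1` on `Δ_Θ/l·Δ_Θ`), the named facts `Prop15iii` (F-0591) / `Prop15ii` (F-2503) / `IsEtThOrigin` (F-2498), a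
`CyclotomeTower`, (H1) `PiYddCharacteristic C` (F-2633 at the instance), the record inputs and Cor 3.5 (K)/(E) DATA exactly as in
p441594, and the MINIMAL function-level package {`T : ThetaKummerInput`, `η̈^Θ = κ(Θ̈)` (`hη`), deck identity `hdeck`, pull-back of
functions `ιFn` over `ι` (`hιFn`) compatible with `Λ(Fn) → Δ_Θ` (`hΛ`), «`ιFn Θ̈ = const(−1)·Θ̈`» (`hιθ`)} — print's inputs
(Prop 1.4 (ii) is about the theta FUNCTION). HONEST CAVEATS: `ThetaKummerInput` is a DATA carrier quoting print (the §1 interface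
has no carrier for functions on `Ÿ`); abc-iut-w5-d125's census (GAP-LEDGER D-G-w4d010-2f 21:51:33Z): the inputs {`hιFn`, `hΛ`,
`hιθ`} with genuine constants are UNSATISFIABLE at the semi-synthetic model `modelχ` for every vertex-0 inner lift — joint
satisfiability of these binders at a model is NOT claimed; over the bare §1 record `h14orbit` stays a hypothesis (abc-iut-w5-d169
18:47:02Z). Composition of landed theorems; no side taken on [IUTchIII] Cor 3.12; typed ≠ proved ≠ endorsed.
-/

noncomputable section

namespace Literature.IUT.HodgeArakelov

open Literature.AnabelianGeometry.EtaleTheta (ContH1 ThetaSetting RootSystem cyclotome)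
open Literature.AnabelianGeometry.EtaleTheta
open EtaleThetaDataOfSetting CohomologySystemOfContH1

/-! ### §1. The root-class-level inputs (R2)(R3), inversion clause from the FUNCTION-level package -/

namespace EtaleThetaDataOfSetting

variable {p : ℕ} [Fact p.Prime] {D : Literature.AnabelianGeometry.EtaleTheta.ThetaSetting p}
  {E : D.EtaleThetaData} {l : ℕ} (C : E.DoubleUnderline l)
  (ι : D.PiTemp ≃ₜ* D.PiTemp) (hι : C.Huu.map ι.toMulEquiv.toMonoidHom = C.Huu) (c : ThetaSetting.ThetaCompanion ι)

/-- **(R2)(R3) at the root-class level, the inversion clause PRODUCED from the function-level [EtTh] Prop 1.4 (ii) package**: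
abc-iut-w4-d010's `rootLevel_inputs_of_classLevel_orbit` (p457998) with its binder `h14orbit` supplied by abc-iut-L2-t12's
`h14orbit_of_thetaKummer` (p465052) — i.e. from `T : ThetaKummerInput` with `η̈^Θ = κ(Θ̈)`, the deck identity `hdeck`, a
pull-back of functions `ιFn` over `ι` (`hιFn`, `hΛ`) and «`ιFn Θ̈ = const(−1)·Θ̈`» (`hιθ`); `h14sign` / `h14free` stay binders
here. Output: (R2) `hsign`, `hroot` and (R3) `hfree` for the chosen root class `η̲̈^Θ`. [cite: MochizukiEtTh2009, Prop 1.4 (ii) p.22] -/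
theorem rootLevel_inputs_of_thetaKummerOrbit [hN : (PiYdd C).Normal] [hYN : D.GtpYdd.Normal] (hS : D.Sec2Hyps)
    (hchar : PiYddCharacteristic C)
    (γ ε : Pi C) (hγ : C.toLZ γ = Multiplicative.ofAdd 1) (hε₁ : (ε : D.PiTemp) ∈ D.GtpY)
    (hε₂ : (ε : D.PiTemp) ∉ D.GtpYdd)
    (δ : Pi C) (hιι : ∀ x : Pi C, ι (ι (x : D.PiTemp)) = (δ : D.PiTemp) * (x : D.PiTemp) * (δ : D.PiTemp)⁻¹)
    (hβ : ∀ a : D.GtpTheta, a ∈ D.DeltaTheta → c.thetaIso a * a⁻¹ ∈ D.lDeltaTheta l)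
    (h14sign : ∃ κ₁ : ContH1 D.toTheta D.DeltaTheta D.GtpYdd, κ₁ ^ 2 = 1 ∧
      ContH1.conj D.toTheta D.DeltaTheta (ε : D.PiTemp) E.etaDd = E.etaDd * κ₁)
    (h14free : ∀ k : ℤ, k ≠ 0 → ¬ IsOfFinOrder
      (ContH1.comap D.toTheta D.DeltaTheta C.Huu.subtype continuous_subtype_val
        (map_subtype_piYdd_inf_le_GtpYdd C ⊤)
        (ContH1.conj D.toTheta D.DeltaTheta ((γ : D.PiTemp) ^ k) E.etaDd * E.etaDd⁻¹)))
    -- the FUNCTION-level [EtTh] Prop 1.4 (ii) package on abc-iut-L2-t12's `ThetaKummerInput`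
    (T : D.ThetaKummerInput) (hη : E.etaDd = T.kummerTheta)
    (hdeck : ∀ e' : D.PiTemp, e' ∈ D.GtpY → e' ∉ D.GtpYdd → e' • T.theta = T.const (-1) * T.theta)
    (ιFn : T.Fn →* T.Fn)
    (hιFn : ∀ (g : Pi C) (fn : T.Fn), ιFn ((g : D.PiTemp) • fn) = ι (g : D.PiTemp) • ιFn fn)
    (hΛ : ∀ ζ : cyclotome T.Fn, ContH1Aut.coeffMap D.DeltaTheta c.thetaIso (thetaCompanion_mem_deltaTheta ι c)
        (T.coeff.hom ζ) = T.coeff.hom (cyclotome.map ιFn ζ))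
    (hιθ : ιFn T.theta = T.const (-1) * T.theta) :
    (∃ κ : ContH1 (phi C) (D.lDeltaTheta l) (PiYdd C ⊓ ⊤), κ ^ 2 = 1 ∧
        ContH1.conj (phi C) (D.lDeltaTheta l) ε (rootLiftClass C) = rootLiftClass C * κ) ∧
      (∃ τ₀ : Pi C, (τ₀ : D.PiTemp) ∈ D.GtpY ∧
        inversionTransport C ι hι c hchar (rootLiftClass C) = ContH1.conj (phi C) (D.lDeltaTheta l) τ₀ (rootLiftClass C)) ∧
      (∀ m n : ℤ, IsOfFinAddOrder
        ((h1Top C).symm (Additive.ofMul (ContH1.conj (phi C) (D.lDeltaTheta l) (γ ^ m) (rootLiftClass C))) -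
          (h1Top C).symm (Additive.ofMul (ContH1.conj (phi C) (D.lDeltaTheta l) (γ ^ n) (rootLiftClass C)))) →
        m = n) :=
  rootLevel_inputs_of_classLevel_orbit C ι hι c hS hchar γ ε hγ hε₁ hε₂ δ hιι hβ h14sign
    (h14orbit_of_thetaKummer C ι hι c hS hchar T hη hdeck ιFn hιFn hΛ hιθ) h14free

/-- **(R2)(R3) at the root-class level with NO `Δ_Θ`-class-level binder**: as `rootLevel_inputs_of_thetaKummerOrbit` with
`h14sign` ⟸ the named fact `Prop15iii` (F-0591; `h14sign_of_prop15iii`) and `h14free` ⟸ `Prop15iii` + `Prop15ii` (F-2503) +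
`IsEtThOrigin` (F-2498) (`h14free_of_prop15_of_origin`); the inversion clause from the function-level package.
[cite: MochizukiEtTh2009, Prop 1.5 (iii) p.23] -/
theorem rootLevel_inputs_of_thetaKummerOrbit_of_prop15_of_origin [hN : (PiYdd C).Normal] [hYN : D.GtpYdd.Normal]
    (hC : D.Compat) (hS : D.Sec2Hyps) (hO : D.IsEtThOrigin) (hchar : PiYddCharacteristic C)
    (h15 : ThetaSetting.Prop15iii E hC) (h15ii : ThetaSetting.Prop15ii E.toKummerData hC)
    (γ ε : Pi C) (hγ : C.toLZ γ = Multiplicative.ofAdd 1) (hε₁ : (ε : D.PiTemp) ∈ D.GtpY)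
    (hε₂ : (ε : D.PiTemp) ∉ D.GtpYdd)
    (δ : Pi C) (hιι : ∀ x : Pi C, ι (ι (x : D.PiTemp)) = (δ : D.PiTemp) * (x : D.PiTemp) * (δ : D.PiTemp)⁻¹)
    (hβ : ∀ a : D.GtpTheta, a ∈ D.DeltaTheta → c.thetaIso a * a⁻¹ ∈ D.lDeltaTheta l)
    (T : D.ThetaKummerInput) (hη : E.etaDd = T.kummerTheta)
    (hdeck : ∀ e' : D.PiTemp, e' ∈ D.GtpY → e' ∉ D.GtpYdd → e' • T.theta = T.const (-1) * T.theta)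
    (ιFn : T.Fn →* T.Fn)
    (hιFn : ∀ (g : Pi C) (fn : T.Fn), ιFn ((g : D.PiTemp) • fn) = ι (g : D.PiTemp) • ιFn fn)
    (hΛ : ∀ ζ : cyclotome T.Fn, ContH1Aut.coeffMap D.DeltaTheta c.thetaIso (thetaCompanion_mem_deltaTheta ι c)
        (T.coeff.hom ζ) = T.coeff.hom (cyclotome.map ιFn ζ))
    (hιθ : ιFn T.theta = T.const (-1) * T.theta) :
    (∃ κ : ContH1 (phi C) (D.lDeltaTheta l) (PiYdd C ⊓ ⊤), κ ^ 2 = 1 ∧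
        ContH1.conj (phi C) (D.lDeltaTheta l) ε (rootLiftClass C) = rootLiftClass C * κ) ∧
      (∃ τ₀ : Pi C, (τ₀ : D.PiTemp) ∈ D.GtpY ∧
        inversionTransport C ι hι c hchar (rootLiftClass C) = ContH1.conj (phi C) (D.lDeltaTheta l) τ₀ (rootLiftClass C)) ∧
      (∀ m n : ℤ, IsOfFinAddOrder
        ((h1Top C).symm (Additive.ofMul (ContH1.conj (phi C) (D.lDeltaTheta l) (γ ^ m) (rootLiftClass C))) -
          (h1Top C).symm (Additive.ofMul (ContH1.conj (phi C) (D.lDeltaTheta l) (γ ^ n) (rootLiftClass C)))) →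
        m = n) :=
  rootLevel_inputs_of_thetaKummerOrbit C ι hι c hS hchar γ ε hγ hε₁ hε₂ δ hιι hβ (h14sign_of_prop15iii C hC hS h15 ε hε₁)
    (h14free_of_prop15_of_origin C hC hO h15 h15ii γ hγ) T hη hdeck ιFn hιFn hΛ hιθ

/-! ### §4 (here for namespace economy). Node IUTchII:Prop2.2(ii): closers of record, inversion clause from the package -/

include hι in
/-- **IUTchII:Prop2.2(ii)′ at the model on the NAMED-FACT route, companion form, the (R2) inversion clause PRODUCED from the
MINIMAL function-level [EtTh] Prop 1.4 (ii) package** (kurims p. 66): abc-iut-w4-d010's `prop22_ii'_model_of_inversion_of_prop15_of_origin_orbit`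
(p457679) with `h14orbit := h14orbit_of_thetaKummer …` and the deck element `ε` (sign clause) from `exists_deck_element`. GIVEN EXACTLY:
the model data; the (R1) inversion datum (`ι`, `hι`, companion `c`, `ℤ`-reversal `hZ` at the `toLZ`-generator `γ`, `ι² = conj δ`,
`ι ≡ +1` on `Δ_Θ/l·Δ_Θ`); the named facts `IsEtThOrigin` (F-2498) / `Prop15iii` (F-0591) / `Prop15ii` (F-2503); {`T`, `hη`, `hdeck`,
`ιFn`, `hιFn`, `hΛ`, `hιθ`}. NO class-level binder. [claim: Mochizuki2012, status: disputed] (IUTchII §2 Prop 2.2 (ii), kurims p.66) -/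
theorem prop22_ii'_model_of_inversion_of_thetaKummerOrbit_of_prop15_of_origin [(PiYdd C).Normal] [D.GtpYdd.Normal]
    (hC : D.Compat) (hS : D.Sec2Hyps) (hchar : PiYddCharacteristic C) (S : BadPlaceSetting.{0})
    (eS : (Pi C) ≃ₜ* S.PiX) (hl : S.l = l) {T₀ : TemperedCoverings S (Pi C)}
    (Dec : SubgraphDecomposition S T₀ (etaleThetaDataOfSetting' C hC hS hchar S.toThetaSetting eS hl))
    -- (R1) the inversion datum
    (γ : Pi C) (hγ : C.toLZ γ = Multiplicative.ofAdd 1) (hZ : D.toZ (ι (γ : D.PiTemp)) = (D.toZ (γ : D.PiTemp))⁻¹)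
    (δ : Pi C) (hιι : ∀ x : Pi C, ι (ι (x : D.PiTemp)) = (δ : D.PiTemp) * (x : D.PiTemp) * (δ : D.PiTemp)⁻¹)
    (hβ : ∀ a : D.GtpTheta, a ∈ D.DeltaTheta → c.thetaIso a * a⁻¹ ∈ D.lDeltaTheta l)
    -- the FUNCTION-level [EtTh] Prop 1.4 (ii) package
    (T : D.ThetaKummerInput) (hη : E.etaDd = T.kummerTheta)
    (hdeck : ∀ e' : D.PiTemp, e' ∈ D.GtpY → e' ∉ D.GtpYdd → e' • T.theta = T.const (-1) * T.theta)
    (ιFn : T.Fn →* T.Fn)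
    (hιFn : ∀ (g : Pi C) (fn : T.Fn), ιFn ((g : D.PiTemp) • fn) = ι (g : D.PiTemp) • ιFn fn)
    (hΛ : ∀ ζ : cyclotome T.Fn, ContH1Aut.coeffMap D.DeltaTheta c.thetaIso (thetaCompanion_mem_deltaTheta ι c)
        (T.coeff.hom ζ) = T.coeff.hom (cyclotome.map ιFn ζ))
    (hιθ : ιFn T.theta = T.const (-1) * T.theta)
    -- the [EtTh] §1 named facts
    (hO : D.IsEtThOrigin) (h15 : ThetaSetting.Prop15iii E hC) (h15ii : ThetaSetting.Prop15ii E.toKummerData hC) :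
    Prop22_ii' Dec := by
  obtain ⟨ε, hε₁, hε₂⟩ := exists_deck_element C hS
  exact prop22_ii'_model_of_inversion_of_prop15_of_origin_orbit C ι hι c hC hS hchar S eS hl Dec γ ε hγ hε₁ hε₂ hZ δ hιι
    hβ (h14orbit_of_thetaKummer C ι hι c hS hchar T hη hdeck ιFn hιFn hΛ hιθ) hO h15 h15ii

include hι in
/-- **IUTchII:Prop2.2(ii)′ at the model on the NAMED-FACT route, ι-datum REDUCED, the (R2) inversion clause PRODUCED from the
MINIMAL function-level package at the CONSTRUCTED companion `thetaCompanionOfAut ι hΔ hq`** (kurims p. 66): abc-iut-w4-d010's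
`prop22_ii'_model_of_hinv_of_prop15_of_origin_orbit` (p457679) with `h14orbit := h14orbit_of_thetaKummer …`, `ε` from
`exists_deck_element`. GIVEN EXACTLY: `ι` with `hι`, `ι(Δ^tp_X) = Δ^tp_X` (`hΔ`), `ι̂ ≡ −1` on `Δ_X^ab` (`hinv`), `ι² = conj δ`, `hq`; the
named facts; {`T`, `hη`, `hdeck`, `ιFn`, `hιFn`, `hΛ`, `hιθ`}. [claim: Mochizuki2012, status: disputed] (IUTchII §2 Prop 2.2 (ii), kurims pp.65-67) -/
theorem prop22_ii'_model_of_hinv_of_thetaKummerOrbit_of_prop15_of_origin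
    (hinv : ∀ g ∈ D.toTemperedCurve.DeltaHat, D.toTemperedCurve.completionAut ι g * g ∈
      (⁅D.toTemperedCurve.DeltaHat, D.toTemperedCurve.DeltaHat⁆).topologicalClosure)
    (hΔ : D.DeltaTemp.map ι.toMulEquiv.toMonoidHom = D.DeltaTemp) (hq : Topology.IsQuotientMap D.toTheta)
    [hN : (PiYdd C).Normal] [hYN : D.GtpYdd.Normal] (hC : D.Compat) (hS : D.Sec2Hyps)
    (hchar : PiYddCharacteristic C) (S : BadPlaceSetting.{0}) (eS : (Pi C) ≃ₜ* S.PiX) (hl : S.l = l)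
    {T₀ : TemperedCoverings S (Pi C)}
    (Dec : SubgraphDecomposition S T₀ (etaleThetaDataOfSetting' C hC hS hchar S.toThetaSetting eS hl))
    (δ : Pi C) (hιι : ∀ x : Pi C, ι (ι (x : D.PiTemp)) = (δ : D.PiTemp) * (x : D.PiTemp) * (δ : D.PiTemp)⁻¹)
    -- the FUNCTION-level [EtTh] Prop 1.4 (ii) package, `hΛ` at the constructed companion
    (T : D.ThetaKummerInput) (hη : E.etaDd = T.kummerTheta)
    (hdeck : ∀ e' : D.PiTemp, e' ∈ D.GtpY → e' ∉ D.GtpYdd → e' • T.theta = T.const (-1) * T.theta)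
    (ιFn : T.Fn →* T.Fn)
    (hιFn : ∀ (g : Pi C) (fn : T.Fn), ιFn ((g : D.PiTemp) • fn) = ι (g : D.PiTemp) • ιFn fn)
    (hΛ : ∀ ζ : cyclotome T.Fn, ContH1Aut.coeffMap D.DeltaTheta (D.thetaCompanionOfAut ι hΔ hq).thetaIso
        (thetaCompanion_mem_deltaTheta ι (D.thetaCompanionOfAut ι hΔ hq)) (T.coeff.hom ζ) =
        T.coeff.hom (cyclotome.map ιFn ζ))
    (hιθ : ιFn T.theta = T.const (-1) * T.theta)
    (hO : D.IsEtThOrigin) (h15 : ThetaSetting.Prop15iii E hC) (h15ii : ThetaSetting.Prop15ii E.toKummerData hC) :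
    Prop22_ii' Dec := by
  obtain ⟨ε, hε₁, hε₂⟩ := exists_deck_element C hS
  exact prop22_ii'_model_of_hinv_of_prop15_of_origin_orbit C ι hι hinv hΔ hq hC hS hchar S eS hl Dec ε hε₁ hε₂ δ hιι
    (h14orbit_of_thetaKummer C ι hι (D.thetaCompanionOfAut ι hΔ hq) hS hchar T hη hdeck ιFn hιFn hΛ hιθ) hO h15 h15ii

end EtaleThetaDataOfSetting

/-! ### §2. `horb` / `hroots` at the GENUINE `θ_env` data, inversion clause from the FUNCTION-level package -/

namespace EtaleLevels

open TemperedThetaMonoids BadPrimeGaussianMonoids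

variable {p : ℕ} [Fact p.Prime] {D : Literature.AnabelianGeometry.EtaleTheta.ThetaSetting p}
  {E : D.EtaleThetaData} {l : ℕ} (C : E.DoubleUnderline l) (hC : D.Compat) (hS : D.Sec2Hyps)
  (hl : l.Prime) (hp2 : p ≠ 2) (hpl : p ≠ l) (hζ : ∃ ζ : D.K, IsPrimitiveRoot ζ (4 * l))
  (mods : ∀ M : ℕ+, D.CyclotomeMod l M)
  (f : contCocycles D.toTheta D.DeltaTheta C.GtpYdduu) (hf : f ∈ C.rootCocycles hC)
  (hmods : ∀ (M M' : ℕ+) (h : (M : ℕ) ∣ (M' : ℕ)) (x : D.lDeltaTheta l),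
    MuN.red p M M' h ((mods M').red x) = (mods M).red x)
  (h15 : Literature.AnabelianGeometry.EtaleTheta.ThetaSetting.Prop15iii E hC) (L : C.CuspLabels)
  (hZ : ∀ M : ℕ+, Nonempty (ModelCyclotomes.lDeltaQuot (C.rigidData (mods M) hC hS h15 L) ≃*
    Literature.IUT.HodgeTheaters.ZHat))
  (hcharY : EtaleThetaDataOfSetting.PiYddCharacteristic C)
  (hlim : Function.Bijective (rigidLimHom C hC hS hl hp2 hpl hζ mods f hf hmods h15 L hZ))
  [(EtaleThetaDataOfSetting.PiYdd C).Normal] [hYN : D.GtpYdd.Normal]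
  (hO : D.IsEtThOrigin) {Es : Set ℕ+} (τc : D.CyclotomeTower l Es)
  -- the [EtTh] inversion datum (any lift of the pointed inversion)
  (ι : D.PiTemp ≃ₜ* D.PiTemp) (hι : C.Huu.map ι.toMulEquiv.toMonoidHom = C.Huu) (cι : ThetaSetting.ThetaCompanion ι)
  (γ ε : Pi C) (hγ : C.toLZ γ = Multiplicative.ofAdd 1) (hε₁ : (ε : D.PiTemp) ∈ D.GtpY)
  (hε₂ : (ε : D.PiTemp) ∉ D.GtpYdd) (hZι : D.toZ (ι (γ : D.PiTemp)) = (D.toZ (γ : D.PiTemp))⁻¹)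
  (δ : Pi C) (hιι : ∀ x : Pi C, ι (ι (x : D.PiTemp)) = (δ : D.PiTemp) * (x : D.PiTemp) * (δ : D.PiTemp)⁻¹)
  (hβ : ∀ a : D.GtpTheta, a ∈ D.DeltaTheta → cι.thetaIso a * a⁻¹ ∈ D.lDeltaTheta l)

include hO τc hγ hε₁ hε₂ hZι hιι hβ

section AnyConstants

variable {Iota : Type}
  (iota : Iota → ((thetaEnvData C hC hS hl hp2 hpl hζ mods f hf hmods h15 L hZ hcharY hlim).D.coh.lim ≃+
    (thetaEnvData C hC hS hl hp2 hpl hζ mods f hf hmods h15 L hZ hcharY hlim).D.coh.lim))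
  {A : Type} [CommGroup A] [MulDistribMulAction (Pi C) A] [TopologicalSpace A] [RootableBy A ℕ]
  (c : CyclotomeCoefficients (phi C) (D.lDeltaTheta l) A)
  (hA : ∀ b : A, IsOpen (MulAction.stabilizer (Pi C) b : Set (Pi C)))
  (hfi : ∀ b : A, (MulAction.stabilizer (Pi C) b).FiniteIndex)
  (O : Submonoid A)

/-- **The Cor 3.5 (ii) junction input `horb` AT THE GENUINE RECORD from the inversion datum (any lift), the named facts and
the function-level [EtTh] Prop 1.4 (ii) package** ([IUTchII] Cor 2.8 (i) p. 82 / Prop 3.1 (i) p. 87): `θ^{i₀}_env(𝕄_*)` is ONE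
`M^×_TM`-orbit, for ANY constants `(A, c, O)` and ANY inversion family with `iota i₀ =` the limit action of `ι` —
abc-iut-w4-d010's `horb_toRecord_inversion_of_classLevel_orbit` (p457998) with every class-level binder supplied as in
`horb_toRecord_inversion_of_thetaKummerOrbit`. [claim: Mochizuki2012, status: disputed] (IUTchII §2 Cor 2.8 (i), kurims p.82) -/
theorem horb_toRecord_inversion_of_thetaKummerOrbit (hc : Function.Bijective c.hom)
    (hOtors : ∀ a : A, IsOfFinOrder a → a ∈ O ∧ a⁻¹ ∈ O) {i₀ : Iota}
    (hi₀ : iota i₀ = pairRhoLim C (inversionAlpha C ι hι) cι.thetaIso (thetaCompanion_phi C ι hι cι)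
      (mem_lDeltaTheta_iff_thetaCompanion ι cι l) (mem_PiYdd_iff_of_piYddCharacteristic C hcharY _))
    {θ : ((thetaEnvData C hC hS hl hp2 hpl hζ mods f hf hmods h15 L hZ hcharY hlim).toRecord
          (h1LimConjMulAut (phi C) (D.lDeltaTheta l) (PiYdd C))
          (h1LimKummerOn (phi C) (D.lDeltaTheta l) (PiYdd C) c hA hfi O) iota).H}
    (hθ : θ ∈ ((thetaEnvData C hC hS hl hp2 hpl hζ mods f hf hmods h15 L hZ hcharY hlim).toRecord
          (h1LimConjMulAut (phi C) (D.lDeltaTheta l) (PiYdd C))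
          (h1LimKummerOn (phi C) (D.lDeltaTheta l) (PiYdd C) c hA hfi O) iota).thetaEnv i₀)
    -- [EtTh] Prop 1.5 (ii) for `E` (F-2503) and the MINIMAL FUNCTION-level [EtTh] Prop 1.4 (ii) package (abc-iut-L2-t12)
    (h15ii : ThetaSetting.Prop15ii E.toKummerData hC)
    (T : D.ThetaKummerInput) (hη : E.etaDd = T.kummerTheta)
    (hdeck : ∀ e' : D.PiTemp, e' ∈ D.GtpY → e' ∉ D.GtpYdd → e' • T.theta = T.const (-1) * T.theta)
    (ιFn : T.Fn →* T.Fn)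
    (hιFn : ∀ (g : Pi C) (fn : T.Fn), ιFn ((g : D.PiTemp) • fn) = ι (g : D.PiTemp) • ιFn fn)
    (hΛ : ∀ ζ : cyclotome T.Fn, ContH1Aut.coeffMap D.DeltaTheta cι.thetaIso (thetaCompanion_mem_deltaTheta ι cι)
        (T.coeff.hom ζ) = T.coeff.hom (cyclotome.map ιFn ζ))
    (hιθ : ιFn T.theta = T.const (-1) * T.theta) :
    ∀ θ' ∈ ((thetaEnvData C hC hS hl hp2 hpl hζ mods f hf hmods h15 L hZ hcharY hlim).toRecord
          (h1LimConjMulAut (phi C) (D.lDeltaTheta l) (PiYdd C))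
          (h1LimKummerOn (phi C) (D.lDeltaTheta l) (PiYdd C) c hA hfi O) iota).thetaEnv i₀,
      ∃ u ∈ ((thetaEnvData C hC hS hl hp2 hpl hζ mods f hf hmods h15 L hZ hcharY hlim).toRecord
          (h1LimConjMulAut (phi C) (D.lDeltaTheta l) (PiYdd C))
          (h1LimKummerOn (phi C) (D.lDeltaTheta l) (PiYdd C) c hA hfi O) iota).units, θ' = u * θ :=
  horb_toRecord_inversion_of_classLevel_orbit C hC hS hl hp2 hpl hζ mods f hf hmods h15 L hZ hcharY hlim hO τc ι hι cι γ ε hγ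
    hε₁ hε₂ hZι δ hιι hβ (h14sign_of_prop15iii C hC hS h15 ε hε₁) (h14free_of_prop15_of_origin C hC hO h15 h15ii γ hγ)
    iota c hA hfi O hc hOtors hi₀ hθ (h14orbit_of_thetaKummer C ι hι cι hS hcharY T hη hdeck ιFn hιFn hΛ hιθ)

/-- **Print's root condition `hroots` AT THE GENUINE RECORD from the inversion datum (any lift), the named facts and the
function-level [EtTh] Prop 1.4 (ii) package** ([IUTchII] Cor 3.5 (ii) p. 95, `∞`-level): every `ϑ ∈ ∞θ^{i₀}_env(𝕄_*)` has
a positive power in `M^×_TM · θ^ℕ` — abc-iut-w4-d010's `hroots_toRecord_inversion_of_classLevel_orbit` (p457998) with every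
class-level binder supplied as in `horb_toRecord_inversion_of_thetaKummerOrbit`.
[claim: Mochizuki2012, status: disputed] (IUTchII §3 Cor 3.5 (ii), kurims p.95) -/
theorem hroots_toRecord_inversion_of_thetaKummerOrbit (hc : Function.Bijective c.hom)
    (hOtors : ∀ a : A, IsOfFinOrder a → a ∈ O ∧ a⁻¹ ∈ O) {i₀ : Iota}
    (hi₀ : iota i₀ = pairRhoLim C (inversionAlpha C ι hι) cι.thetaIso (thetaCompanion_phi C ι hι cι)
      (mem_lDeltaTheta_iff_thetaCompanion ι cι l) (mem_PiYdd_iff_of_piYddCharacteristic C hcharY _))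
    {θ : ((thetaEnvData C hC hS hl hp2 hpl hζ mods f hf hmods h15 L hZ hcharY hlim).toRecord
          (h1LimConjMulAut (phi C) (D.lDeltaTheta l) (PiYdd C))
          (h1LimKummerOn (phi C) (D.lDeltaTheta l) (PiYdd C) c hA hfi O) iota).H}
    (hθ : θ ∈ ((thetaEnvData C hC hS hl hp2 hpl hζ mods f hf hmods h15 L hZ hcharY hlim).toRecord
          (h1LimConjMulAut (phi C) (D.lDeltaTheta l) (PiYdd C))
          (h1LimKummerOn (phi C) (D.lDeltaTheta l) (PiYdd C) c hA hfi O) iota).thetaEnv i₀)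
    -- [EtTh] Prop 1.5 (ii) for `E` (F-2503) and the MINIMAL FUNCTION-level [EtTh] Prop 1.4 (ii) package (abc-iut-L2-t12)
    (h15ii : ThetaSetting.Prop15ii E.toKummerData hC)
    (T : D.ThetaKummerInput) (hη : E.etaDd = T.kummerTheta)
    (hdeck : ∀ e' : D.PiTemp, e' ∈ D.GtpY → e' ∉ D.GtpYdd → e' • T.theta = T.const (-1) * T.theta)
    (ιFn : T.Fn →* T.Fn)
    (hιFn : ∀ (g : Pi C) (fn : T.Fn), ιFn ((g : D.PiTemp) • fn) = ι (g : D.PiTemp) • ιFn fn)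
    (hΛ : ∀ ζ : cyclotome T.Fn, ContH1Aut.coeffMap D.DeltaTheta cι.thetaIso (thetaCompanion_mem_deltaTheta ι cι)
        (T.coeff.hom ζ) = T.coeff.hom (cyclotome.map ιFn ζ))
    (hιθ : ιFn T.theta = T.const (-1) * T.theta) :
    ∀ ϑ ∈ ((thetaEnvData C hC hS hl hp2 hpl hζ mods f hf hmods h15 L hZ hcharY hlim).toRecord
          (h1LimConjMulAut (phi C) (D.lDeltaTheta l) (PiYdd C))
          (h1LimKummerOn (phi C) (D.lDeltaTheta l) (PiYdd C) c hA hfi O) iota).inftyThetaEnv i₀,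
      ∃ N : ℕ, 0 < N ∧ ϑ ^ N ∈ splitMonoid ((thetaEnvData C hC hS hl hp2 hpl hζ mods f hf hmods h15 L hZ hcharY hlim).toRecord
          (h1LimConjMulAut (phi C) (D.lDeltaTheta l) (PiYdd C))
          (h1LimKummerOn (phi C) (D.lDeltaTheta l) (PiYdd C) c hA hfi O) iota).units (Submonoid.powers θ) :=
  hroots_toRecord_inversion_of_classLevel_orbit C hC hS hl hp2 hpl hζ mods f hf hmods h15 L hZ hcharY hlim hO τc ι hι cι γ ε
    hγ hε₁ hε₂ hZι δ hιι hβ (h14sign_of_prop15iii C hC hS h15 ε hε₁) (h14free_of_prop15_of_origin C hC hO h15 h15ii γ hγ)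
    iota c hA hfi O hc hOtors hi₀ hθ (h14orbit_of_thetaKummer C ι hι cι hS hcharY T hη hdeck ιFn hιFn hΛ hιθ)

end AnyConstants

/-! ### §3. [IUTchII] Prop 3.1 (i) «splittings up to torsion» over `ℚ̄_pˣ` (junction J3), (R2)(R3) and `hker` DISCHARGED -/

omit hε₁ hε₂ in
/-- **[IUTchII] Prop 3.1 (i) «splittings up to torsion» AT THE GENERIC GENUINE `θ_env` DATA over `ℚ̄_pˣ`, NO class-level
binder, NO `hker`**: abc-iut-w4-d004's closer of record `splitting_toRecord_padic_of_eval_pairRhoLim` (p441594) for the (R1)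
pointed-inversion PAIR `(inversionAlpha C ι hι, ι^Θ)` (`hαγ` ⟸ abc-iut-w5-d072's `toLZ_inversionAlpha_generator` from `hZι`), a deck
element from `exists_deck_element`, (R2)(R3) ⟸ `rootLevel_inputs_of_thetaKummerOrbit_of_prop15_of_origin` (named facts + the MINIMAL
function-level package) and `hker` ⟸ `IsEtThOrigin` + the cyclotome tower (`hfix_of_cyclotomeTower`, `hker_coh_of_fixed`) — the
abc-iut-w5-d072 stage-2 template `splitting_toRecord_padic_of_eval_modelχq` (p460211) at an ARBITRARY theta setting. RESIDUAL (all
binders): inversion datum, `Prop15iii`/`Prop15ii`/`IsEtThOrigin`, tower, (H1), record inputs, the Cor 3.5 (K)/(E) DATA (constants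
`c`/`c₀` bijective with `μ ⊆ O`, ONE evaluation section `s₀` with `hact` and finite-index image, `R₀ θ = κ₀ q` with `q` a non-unit,
the family `iota`, a base point `θ ∈ θ^{i₀}_env`) and {`T`, `hη`, `hdeck`, `ιFn`, `hιFn`, `hΛ`, `hιθ`}.
[claim: Mochizuki2012, status: disputed] (IUTchII §3 Prop 3.1 (i), kurims p.87) -/
theorem splitting_toRecord_padic_of_eval_inversion_of_thetaKummerOrbit
    {Iota : Type}
    (iota : Iota → ((thetaEnvData C hC hS hl hp2 hpl hζ mods f hf hmods h15 L hZ hcharY hlim).D.coh.lim ≃+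
      (thetaEnvData C hC hS hl hp2 hpl hζ mods f hf hmods h15 L hZ hcharY hlim).D.coh.lim))
    {P₀ : TopGroup.{0}} (φ₀ : P₀ →* D.GtpTheta) (s₀ : P₀ →* Pi C)
    (hs₀ : Continuous ((MonoidHom.id (Pi C)).comp s₀))
    (hN : (⊤ : Subgroup P₀).map ((MonoidHom.id (Pi C)).comp s₀) ≤ PiYdd C)
    (hφ : (phi C).comp ((MonoidHom.id (Pi C)).comp s₀) = φ₀)
    [TopologicalSpace (PadicAlgCl p)ˣ]
    (c : CyclotomeCoefficients (phi C) (D.lDeltaTheta l) (PadicAlgCl p)ˣ)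
    (hA : ∀ b : (PadicAlgCl p)ˣ, IsOpen (MulAction.stabilizer (Pi C) b : Set (Pi C)))
    (hfi : ∀ b : (PadicAlgCl p)ˣ, (MulAction.stabilizer (Pi C) b).FiniteIndex)
    (O : Submonoid (PadicAlgCl p)ˣ)
    [MulDistribMulAction P₀ (PadicAlgCl p)ˣ]
    (c₀ : CyclotomeCoefficients φ₀ (D.lDeltaTheta l) (PadicAlgCl p)ˣ)
    (hA₀ : ∀ b : (PadicAlgCl p)ˣ, IsOpen (MulAction.stabilizer P₀ b : Set P₀))
    (hfi₀ : ∀ b : (PadicAlgCl p)ˣ, (MulAction.stabilizer P₀ b).FiniteIndex)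
    (hc : Function.Bijective c.hom) (hOtors : ∀ a : (PadicAlgCl p)ˣ, IsOfFinOrder a → a ∈ O ∧ a⁻¹ ∈ O)
    (hc₀ : Function.Bijective c₀.hom) (hc₀c : ∀ ζ, c₀.hom ζ = c.hom ζ)
    (hact : ∀ (g : P₀) (a : (PadicAlgCl p)ˣ), g • a = s₀ g • a)
    [((EtaleThetaDataOfSetting.aug C).comp s₀).range.FiniteIndex]
    {i₀ : Iota}
    (hi₀ : iota i₀ = pairRhoLim C (inversionAlpha C ι hι) cι.thetaIso (thetaCompanion_phi C ι hι cι)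
      (mem_lDeltaTheta_iff_thetaCompanion ι cι l) (mem_PiYdd_iff_of_piYddCharacteristic C hcharY _))
    {θ : ((thetaEnvData C hC hS hl hp2 hpl hζ mods f hf hmods h15 L hZ hcharY hlim).toRecord
        (h1LimConjMulAut (phi C) (D.lDeltaTheta l) (PiYdd C))
        (h1LimKummerOn (phi C) (D.lDeltaTheta l) (PiYdd C) c hA hfi O) iota).H}
    (hθ : θ ∈ ((thetaEnvData C hC hS hl hp2 hpl hζ mods f hf hmods h15 L hZ hcharY hlim).toRecord
        (h1LimConjMulAut (phi C) (D.lDeltaTheta l) (PiYdd C))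
        (h1LimKummerOn (phi C) (D.lDeltaTheta l) (PiYdd C) c hA hfi O) iota).thetaEnv i₀)
    (R₀ : ((thetaEnvData C hC hS hl hp2 hpl hζ mods f hf hmods h15 L hZ hcharY hlim).toRecord
        (h1LimConjMulAut (phi C) (D.lDeltaTheta l) (PiYdd C))
        (h1LimKummerOn (phi C) (D.lDeltaTheta l) (PiYdd C) c hA hfi O) iota).H →*
      Multiplicative (h1Lim φ₀ (D.lDeltaTheta l) (⊤ : Subgroup P₀) ⊥))
    (hR₀ : ∀ y, Multiplicative.toAdd (R₀ y) =
      h1LimCongr (D.lDeltaTheta l) ⊤ hφ ⊥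
        (h1LimComap (phi C) (D.lDeltaTheta l) ((MonoidHom.id (Pi C)).comp s₀) hs₀ hN
          (AddEquiv.additiveMultiplicative (h1Lim (phi C) (D.lDeltaTheta l) (PiYdd C) ⊥) (Additive.ofMul y))))
    (q : O) (hRθ : R₀ θ = h1LimKummerOn φ₀ (D.lDeltaTheta l) ⊤ c₀ hA₀ hfi₀ O q) (hq : ¬ IsUnit q)
    -- [EtTh] Prop 1.5 (ii) for `E` (F-2503) and the MINIMAL FUNCTION-level [EtTh] Prop 1.4 (ii) package (abc-iut-L2-t12)
    (h15ii : ThetaSetting.Prop15ii E.toKummerData hC)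
    (T : D.ThetaKummerInput) (hη : E.etaDd = T.kummerTheta)
    (hdeck : ∀ e' : D.PiTemp, e' ∈ D.GtpY → e' ∉ D.GtpYdd → e' • T.theta = T.const (-1) * T.theta)
    (ιFn : T.Fn →* T.Fn)
    (hιFn : ∀ (g : Pi C) (fn : T.Fn), ιFn ((g : D.PiTemp) • fn) = ι (g : D.PiTemp) • ιFn fn)
    (hΛ : ∀ ζ : cyclotome T.Fn, ContH1Aut.coeffMap D.DeltaTheta cι.thetaIso (thetaCompanion_mem_deltaTheta ι cι)
        (T.coeff.hom ζ) = T.coeff.hom (cyclotome.map ιFn ζ))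
    (hιθ : ιFn T.theta = T.const (-1) * T.theta) :
    IsSplittingUpToTorsion
        ((thetaEnvData C hC hS hl hp2 hpl hζ mods f hf hmods h15 L hZ hcharY hlim).toRecord
          (h1LimConjMulAut (phi C) (D.lDeltaTheta l) (PiYdd C))
          (h1LimKummerOn (phi C) (D.lDeltaTheta l) (PiYdd C) c hA hfi O) iota).units
        (Submonoid.closure (((thetaEnvData C hC hS hl hp2 hpl hζ mods f hf hmods h15 L hZ hcharY hlim).toRecord
          (h1LimConjMulAut (phi C) (D.lDeltaTheta l) (PiYdd C))
          (h1LimKummerOn (phi C) (D.lDeltaTheta l) (PiYdd C) c hA hfi O) iota).inftyThetaEnv i₀)) ∧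
      IsSplittingUpToTorsion
        ((thetaEnvData C hC hS hl hp2 hpl hζ mods f hf hmods h15 L hZ hcharY hlim).toRecord
          (h1LimConjMulAut (phi C) (D.lDeltaTheta l) (PiYdd C))
          (h1LimKummerOn (phi C) (D.lDeltaTheta l) (PiYdd C) c hA hfi O) iota).units
        (Submonoid.closure (((thetaEnvData C hC hS hl hp2 hpl hζ mods f hf hmods h15 L hZ hcharY hlim).toRecord
          (h1LimConjMulAut (phi C) (D.lDeltaTheta l) (PiYdd C))
          (h1LimKummerOn (phi C) (D.lDeltaTheta l) (PiYdd C) c hA hfi O) iota).thetaEnv i₀)) := by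
  obtain ⟨ε', hε'₁, hε'₂⟩ := exists_deck_element C hS  -- deck element ([EtTh] Def 2.7), for the sign clause
  obtain ⟨hsign, hroot, hfree⟩ := rootLevel_inputs_of_thetaKummerOrbit_of_prop15_of_origin C ι hι cι hC hS hO hcharY h15 h15ii
    γ ε' hγ hε'₁ hε'₂ δ hιι hβ T hη hdeck ιFn hιFn hΛ hιθ
  exact splitting_toRecord_padic_of_eval_pairRhoLim C hC hS hl hp2 hpl hζ mods f hf hmods h15 L hZ hcharY hlim iota φ₀ s₀ hs₀
    hN hφ c hA hfi O c₀ hA₀ hfi₀ hc hOtors (inversionAlpha C ι hι) cι.thetaIso (thetaCompanion_phi C ι hι cι)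
    (mem_lDeltaTheta_iff_thetaCompanion ι cι l) (mem_PiYdd_iff_of_piYddCharacteristic C hcharY _) γ ε' hγ hε'₁ hε'₂
    (toLZ_inversionAlpha_generator C ι hι γ hγ hZι) hsign hroot hfree
    (hker_coh_of_fixed C (hfix_of_cyclotomeTower C hO τc)) hc₀ hc₀c hact hi₀ hθ R₀ hR₀ q hRθ hq

end EtaleLevels

end Literature.IUT.HodgeArakelov

end
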